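import Summits.NavierStokesRegularity.NavierStokesRegularity.Theorems.OddMorawetzLocal.Negative.OddMorawetzLocalRefutationData5
import Summits.NavierStokesRegularity.NavierStokesRegularity.Theorems.OddMorawetzLocal.Negative.OddMorawetzLocalRefutationDefsV
import HarnessLib

/-!
# Crux `OddMorawetzLocal` (stmt-NavierStokesRegularity-1376) — kernel certificates, weight 5 (part A1)

The finite computations of the weight-5 half of the refutation, each a closed Boolean evaluated by the kernel
(`decide +kernel`) on the vocabulary of `OddMorawetzLocalJetAlgebra` / `…RefutationDefs{,Fast,IV,V}` and the literal
data of `…RefutationData5` (197 orbit representatives `reps5`, 50 isotropic descriptors `isoDesc5`, three certificate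
blocks `blocks5` of sizes 53/45/49, the independence columns `kcols5` and inverse `cinv5`, prime 8191).
Part A1: `cert5_e1_*` — the orbit-sum identities `e1Check 5 reps5 lo n` (step E1: a `B₃`-fixed coefficient vector lies in
the span of the 197 normalised orbit sums) for the basis monomials of the listed ranges, in chunks of 100 (kernel memory).
No analysis; lands `--supports` the crux item; consumed by the weight-5 assembly of the refutation.
-/

set_option linter.dupNamespace false

namespace Summit.NavierStokesRegularity.NavierStokesRegularity.Theorems.OddMorawetz

/-- Orbit-sum identities for the weight-5 basis monomials `0 … 99`. -/
theorem cert5_e1_0 : e1Check 5 reps5 0 100 = true := by decide +kernel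

/-- Orbit-sum identities for the weight-5 basis monomials `100 … 199`. -/
theorem cert5_e1_1 : e1Check 5 reps5 100 100 = true := by decide +kernel

/-- Orbit-sum identities for the weight-5 basis monomials `200 … 299`. -/
theorem cert5_e1_2 : e1Check 5 reps5 200 100 = true := by decide +kernel

/-- Orbit-sum identities for the weight-5 basis monomials `300 … 399`. -/
theorem cert5_e1_3 : e1Check 5 reps5 300 100 = true := by decide +kernel

/-- Orbit-sum identities for the weight-5 basis monomials `400 … 499`. -/
theorem cert5_e1_4 : e1Check 5 reps5 400 100 = true := by decide +kernel

/-- Orbit-sum identities for the weight-5 basis monomials `500 … 599`. -/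
theorem cert5_e1_5 : e1Check 5 reps5 500 100 = true := by decide +kernel

/-- Orbit-sum identities for the weight-5 basis monomials `600 … 699`. -/
theorem cert5_e1_6 : e1Check 5 reps5 600 100 = true := by decide +kernel

/-- Orbit-sum identities for the weight-5 basis monomials `700 … 799`. -/
theorem cert5_e1_7 : e1Check 5 reps5 700 100 = true := by decide +kernel

/-- Orbit-sum identities for the weight-5 basis monomials `800 … 899`. -/
theorem cert5_e1_8 : e1Check 5 reps5 800 100 = true := by decide +kernel

/-- Orbit-sum identities for the weight-5 basis monomials `900 … 999`. -/
theorem cert5_e1_9 : e1Check 5 reps5 900 100 = true := by decide +kernel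

/-- Orbit-sum identities for the weight-5 basis monomials `1000 … 1099`. -/
theorem cert5_e1_10 : e1Check 5 reps5 1000 100 = true := by decide +kernel

/-- Orbit-sum identities for the weight-5 basis monomials `1100 … 1199`. -/
theorem cert5_e1_11 : e1Check 5 reps5 1100 100 = true := by decide +kernel

/-- Orbit-sum identities for the weight-5 basis monomials `1200 … 1299`. -/
theorem cert5_e1_12 : e1Check 5 reps5 1200 100 = true := by decide +kernel

/-- Orbit-sum identities for the weight-5 basis monomials `1300 … 1399`. -/
theorem cert5_e1_13 : e1Check 5 reps5 1300 100 = true := by decide +kernel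

/-- Orbit-sum identities for the weight-5 basis monomials `1400 … 1499`. -/
theorem cert5_e1_14 : e1Check 5 reps5 1400 100 = true := by decide +kernel

/-- Orbit-sum identities for the weight-5 basis monomials `1500 … 1599`. -/
theorem cert5_e1_15 : e1Check 5 reps5 1500 100 = true := by decide +kernel

end Summit.NavierStokesRegularity.NavierStokesRegularity.Theorems.OddMorawetz
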